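import Literature.Analysis.SpecialFunctions.GlaisherThetaKIdentity
import Literature.Analysis.SpecialFunctions.HurwitzLatticeSumMellin
import HarnessLib

/-!
# Zhou 2013, Proposition 5.1: `∫₀¹ K(√(1−k²))³ dk = Γ(¼)⁸/(128π²)` — the value (discharge)

Topic `Literature/Analysis/SpecialFunctions`; discharges the named fact
`Literature.Analysis.SpecialFunctions.Zhou2013_prop_5_1` of `ZhouTripleEllipticIntegral.lean`
(Y. Zhou, *Legendre functions, spherical rotations, and multiple elliptic integrals*, Ramanujan J.
34 (2014) 373–428, arXiv:1301.1735, Prop. 5.1, first member = last member of the printed chain).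

Zhou's printed proof reduces the value, through a Tricomi pairing and Landen transformations
(all five chain equalities are proved in the tree: `ZhouTripleEllipticIntegralProofs.lean`,
`…Wick.lean`), to his eq. (T_half_half) (Cor. 3.2), itself obtained from complex-degree Legendre
asymptotics (§3). For the transcendental input we follow instead the modular route of
Rogers–Wan–Zucker (arXiv:1303.2259, Thm 1: "`∫₀¹K′(k)³dk = … = Γ⁸(¼)/(128π²)`", §3), entirely
with results proved in the tree:

1. `∫₀¹K′³ = 5∫₀¹kK′³dk` (Landen; `integral_Kcompl_pow_three_eq_five_mul'`);
2. Glaisher's identity at the nome `q = e^{−πK′/K}` (`GlaisherThetaKIdentity.lean`, from Jacobi's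
   inversion theorem `K = (π/2)θ₃²` and the derivatives of `K, E, K′/K`):
   `Θ(σ) := ∑_{(m,n)}(m⁴−6m²n²+n⁴)e^{−π(m²+n²)σ} = (8/π⁵)k²k′²K⁵` at `σ = K′/K`;
3. the substitution `σ = K′/K`, `dσ = −π dk/(2kk′²K²)` (`integral_Ioi_eq_integral_periodRatio`):
   `∫₀^∞ σ³Θ(σ)dσ = (4/π⁴)∫₀¹ kK′³dk`;
4. the Mellin transform and Hurwitz's lattice sum (`HurwitzLatticeSumMellin.lean`, from the tree's
   `E₄(i)`/`g₂(ℤi+ℤ) = Γ(¼)⁸/(16π²)`): `∫₀^∞σ³Θ(σ)dσ = (6/π⁴)∑′(m⁴−6m²n²+n⁴)/(m²+n²)⁴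
   = (6/π⁴)·Γ(¼)⁸/(960π²)`.

Hence `∫₀¹kK′³dk = Γ(¼)⁸/(640π²)` (`integral_completeEllipticK_compl_pow_three_mul_id_eq`) and
**`Zhou2013_prop_5_1_holds`**. No new definitions, no new named facts.

## References

* [Zhou2013] Y. Zhou, Ramanujan J. 34 (2014) 373–428, arXiv:1301.1735, Prop. 5.1 (p. 23).
* [RogersWanZucker2013] M. Rogers, J. G. Wan, I. J. Zucker, Ramanujan J. 37 (2015) 113–130,
  arXiv:1303.2259, Thm 1, Thm 2, §3.
-/

noncomputable section

open Real _root_.MeasureTheory _root_.Set _root_.Filter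
open scoped _root_.Topology Real

namespace Literature.Analysis.SpecialFunctions

/-- **Step 3 of the modular route**: the Mellin integral of the Glaisher theta series equals
`(4/π⁴)∫₀¹ kK(√(1−k²))³dk` (substitution `σ = K′/K` and Glaisher's identity).
[cite: RogersWanZucker2013, §3] -/
theorem integral_Ioi_pow_three_mul_glaisherTheta_eq_moment :
    ∫ σ in Ioi (0 : ℝ), ∑' p : ℤ × ℤ, ((p.1 : ℝ) ^ 4 - 6 * (p.1 : ℝ) ^ 2 * (p.2 : ℝ) ^ 2 + (p.2 : ℝ) ^ 4) *
        (σ ^ 3 * rexp (-(π * ((p.1 : ℝ) ^ 2 + (p.2 : ℝ) ^ 2) * σ))) =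
      4 / π ^ 4 * ∫ k in Ioo (0 : ℝ) 1, completeEllipticK (Real.sqrt (1 - k ^ 2)) ^ 3 * k := by
  rw [integral_Ioi_eq_integral_periodRatio (fun σ => ∑' p : ℤ × ℤ,
      ((p.1 : ℝ) ^ 4 - 6 * (p.1 : ℝ) ^ 2 * (p.2 : ℝ) ^ 2 + (p.2 : ℝ) ^ 4) *
        (σ ^ 3 * rexp (-(π * ((p.1 : ℝ) ^ 2 + (p.2 : ℝ) ^ 2) * σ)))), ← integral_const_mul]
  refine setIntegral_congr_fun measurableSet_Ioo (fun k hk => ?_)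
  set σ : ℝ := completeEllipticK (Real.sqrt (1 - k ^ 2)) / completeEllipticK k with hσ
  -- pull `σ³` out of the series and use Glaisher's identity
  have hser : ∑' p : ℤ × ℤ, ((p.1 : ℝ) ^ 4 - 6 * (p.1 : ℝ) ^ 2 * (p.2 : ℝ) ^ 2 + (p.2 : ℝ) ^ 4) *
      (σ ^ 3 * rexp (-(π * ((p.1 : ℝ) ^ 2 + (p.2 : ℝ) ^ 2) * σ))) =
      σ ^ 3 * (8 / π ^ 5 * (k ^ 2 * (1 - k ^ 2)) * completeEllipticK k ^ 5) := by
    rw [← glaisherLatticeSum_periodRatio hk, ← hσ, ← tsum_mul_left]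
    refine tsum_congr (fun p => ?_)
    rw [show (-(π * ((p.1 : ℝ) ^ 2 + (p.2 : ℝ) ^ 2) * σ)) = -π * ((p.1 : ℝ) ^ 2 + (p.2 : ℝ) ^ 2) * σ by ring]
    ring
  rw [hser, hσ]
  have hk0 : k ≠ 0 := hk.1.ne'
  have hk1 : 1 - k ^ 2 ≠ 0 := by nlinarith [hk.1, hk.2]
  have hK : completeEllipticK k ≠ 0 := (completeEllipticK_pos (by nlinarith [hk.1, hk.2])).ne'
  have hπ : π ≠ 0 := Real.pi_pos.ne'
  field_simp
  ring

/-- **The cubic moment `∫₀¹ kK(√(1−k²))³dk = Γ(¼)⁸/(640π²)`** (`= (2/5)K(1/√2)⁴`;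
Rogers–Wan–Zucker Thm 1 with `∫₀¹K′³ = 5∫₀¹kK′³`). [cite: RogersWanZucker2013, Thm 1 and §3] -/
theorem integral_completeEllipticK_compl_pow_three_mul_id_eq :
    ∫ k in Ioo (0 : ℝ) 1, completeEllipticK (Real.sqrt (1 - k ^ 2)) ^ 3 * k =
      Real.Gamma (1 / 4) ^ 8 / (640 * π ^ 2) := by
  have h1 := integral_Ioi_pow_three_mul_glaisherTheta_eq_moment
  rw [integral_Ioi_pow_three_mul_glaisherTheta, hurwitz_latticeSum_re] at h1
  have hπ : π ≠ 0 := Real.pi_pos.ne'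
  have h4 : (4 / π ^ 4 : ℝ) ≠ 0 := by positivity
  apply mul_left_cancel₀ h4
  rw [← h1]
  field_simp
  ring

/-- **Zhou 2013, Proposition 5.1 (discharge of the named fact)**:
`∫₀¹ K(√(1−k²))³ dk = Γ(¼)⁸/(128π²)`. [cite: Zhou2013, Prop. 5.1 (arXiv p. 23); RogersWanZucker2013, Thm 1] -/
theorem Zhou2013_prop_5_1_holds : Zhou2013_prop_5_1 := by
  unfold Zhou2013_prop_5_1
  rw [integral_Kcompl_pow_three_eq_five_mul', integral_completeEllipticK_compl_pow_three_mul_id_eq]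
  ring

end Literature.Analysis.SpecialFunctions

end
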